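import Summits.HodgeConjecture.CorCM.GaloisTwentyFourC3SemidirectC8Degenerate
import Summits.HodgeConjecture.CorCM.GaloisCyclicSemidirectEightTwoSheet
import Mathlib.GroupTheory.SemidirectProduct
import HarnessLib

/-!
# The balanced-set certificate format for `Gal(K/ℚ) ≅ C_p ⋊_r C_{2^{k+1}}`, read in the coordinates `ℤ/p × ℤ/2^{k+1}`

COR-CM (cell `pub-hodgecm2`), binder seat b04 (gen 26), count-neutral claim CYCLIC-SEMIDIRECT-RESIDUE, part VI♯ — the BAD side of
the metacyclic families.  `G₀ = C_p ⋊_r C_{2^{k+1}} = ⟨u, y | u^p = y^{2^{k+1}} = 1, y u y⁻¹ = u^r⟩` with `p` an odd prime and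
`r^{2^k} ≡ 1 (mod p)` (so that `c₀ = y^{2^k}` is central — it is then the UNIQUE involution, `involution_eq`); Mathlib model
`Multiplicative (ZMod p) ⋊[φ] Multiplicative (ZMod (2^(k+1)))` with `φ(1) = (·)^r`.  For `r ≡ −1` these are the groups of
`CorCM/GaloisCyclicSemidirectTwoPower*` (`k = a + 1`; GOOD iff `2^{a+2} ∤ p − 1 ∧ 2^{a+1} ∤ p + 1`, the «if» proved there); for `r`
of order `2^j ≥ 4` the annihilator blocks are reduced norms in a cyclic algebra of degree `2^j` (gen-26 FRONTIER).  On the BAD side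
degeneracy is witnessed by KERNEL CERTIFICATES in gen 20's balanced-set format on a table model
(`GaloisModels.exists_simple_degenerate_of_table_balanced`); this file transports that format to the hypothesis
`e : Gal(K/ℚ) ≃* Multiplicative (ZMod p) ⋊[φ] Multiplicative (ZMod (2^(k+1)))`: the bijection `u^v y^s ↦ (v, s) ∈ ℤ/p × ℤ/2^{k+1}`
turns the group law into `(v₁, s₁)·(v₂, s₂) = (v₁ + r^{s₁} v₂, s₁ + s₂)`, complex conjugation into `(0, 2^k)` and the identity into
`(0, 0)`, so that a CM set `T₀` with trivial left stabiliser and a balanced set `D` — checked by `decide` — give a simple DEGENERATE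
abelian variety of dimension `2^k p` with CM by `K`.  KERNEL ONLY: theorems; no definition, no named fact, no `sorry`.  `HC_CM` is
neither used nor claimed.  NB the format takes `(hp : p.Prime)` explicitly and assumes no `Fact` instance, so that the certificate
hypotheses elaborate through `ZMod.commRing` only and stay `decide`-able at the call site.

* §1 `phi_pow_apply`, `phi_apply` (`φ(t)(v) = v^{r^t}`), `toAdd_phi_apply`, `toAdd_mul_left`, `pow_mod_prime`,
  `eq_zero_or_eq_half`, **`involution_eq`** (`y^{2^k}` is the unique involution), `map_complexConj_eq`, `card_eq`.
* §2 **`exists_simple_degenerate_of_metacyclic_balanced`** — the certificate format; `…_of_inversion_balanced` — the same under the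
  hypothesis `φ(1) = (·)⁻¹` of the `CorCM/GaloisCyclicSemidirectTwoPower*` files.

## References

* [Shimura1998] G. Shimura, *Abelian Varieties with Complex Multiplication and Modular Functions*, §6.2 Thm. 3, §8.2 Prop. 26.
* [Gordon1999HodgeAVSurvey] B. B. Gordon, *A survey of the Hodge conjecture for abelian varieties*, Thm. 6.4, §9.3.
* [Dodson1984] B. Dodson, *The structure of Galois groups of CM-fields*, Trans. AMS 283 (1984), §5.3.
-/

noncomputable section

open CategoryTheory CategoryTheory.Limits NumberField
open scoped BigOperators

namespace Summit.HodgeConjecture.CorCM.GaloisOddMetacyclic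

open Literature.NumberTheory.ComplexMultiplication
open Literature.AlgebraicGeometry.Motives (AbelianVariety CMType)
open Literature.AlgebraicGeometry.HodgeTheory
open Literature.AlgebraicGeometry.ComplexMultiplication (IsCMTypeRealisation)
open Literature.AlgebraicGeometry.Pohlmann1968
open Literature.Barriers.HodgeConjecture (divisorClassesSpan)
open Summit.HodgeConjecture.CorCM.GaloisModels (exists_simple_degenerate_of_table_balanced)
open Summit.HodgeConjecture.CorCM.GaloisRank (model_complexConj_mul_self model_complexConj_ne_one card_model_eq_finrank)

/-! ## §1 The group `C_p ⋊_r C_{2^{k+1}}` in coordinates -/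

section Group

variable {p k : ℕ} (r : ℕ)
variable (φ : Multiplicative (ZMod (2 ^ (k + 1))) →* MulAut (Multiplicative (ZMod p)))
  (hφ : ∀ v : Multiplicative (ZMod p), φ (Multiplicative.ofAdd 1) v = v ^ r)

include hφ in
/-- `φ(1)^n (v) = v^{r^n}`. [folklore] -/
theorem phi_pow_apply (n : ℕ) (v : Multiplicative (ZMod p)) :
    φ (Multiplicative.ofAdd (1 : ZMod (2 ^ (k + 1))) ^ n) v = v ^ r ^ n := by
  induction n generalizing v with
  | zero => simp
  | succ n ih =>
    rw [pow_succ (Multiplicative.ofAdd (1 : ZMod (2 ^ (k + 1)))) n, map_mul, MulAut.mul_apply, hφ, ih, ← pow_mul,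
      pow_succ']

include hφ in
/-- **`φ(t)(v) = v^{r^t}`** (`t` read in `ℤ/2^{k+1}` through its representative `t.val`). [folklore] -/
theorem phi_apply (t : Multiplicative (ZMod (2 ^ (k + 1)))) (v : Multiplicative (ZMod p)) :
    φ t v = v ^ r ^ (Multiplicative.toAdd t).val := by
  haveI : NeZero (2 ^ (k + 1)) := ⟨by positivity⟩
  have ht : t = Multiplicative.ofAdd (1 : ZMod (2 ^ (k + 1))) ^ (Multiplicative.toAdd t).val := by
    rw [← ofAdd_nsmul, nsmul_eq_mul, mul_one, ZMod.natCast_zmod_val, ofAdd_toAdd]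
  conv_lhs => rw [ht]
  exact phi_pow_apply r φ hφ _ v

include hφ in
/-- `toAdd (φ t v) = r^{t} · toAdd v` in `ℤ/p`. [folklore] -/
theorem toAdd_phi_apply (t : Multiplicative (ZMod (2 ^ (k + 1)))) (v : Multiplicative (ZMod p)) :
    Multiplicative.toAdd (φ t v) = ((r ^ (Multiplicative.toAdd t).val : ℕ) : ZMod p) * Multiplicative.toAdd v := by
  rw [phi_apply r φ hφ, toAdd_pow, nsmul_eq_mul]

include hφ in
/-- The first coordinate of a product: `toAdd ((g h).left) = toAdd g.left + r^{g.right} · toAdd h.left`. [folklore] -/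
theorem toAdd_mul_left (g h : Multiplicative (ZMod p) ⋊[φ] Multiplicative (ZMod (2 ^ (k + 1)))) :
    Multiplicative.toAdd (g * h).left =
      Multiplicative.toAdd g.left +
        ((r ^ (Multiplicative.toAdd g.right).val : ℕ) : ZMod p) * Multiplicative.toAdd h.left := by
  rw [SemidirectProduct.mul_left, toAdd_mul, toAdd_phi_apply r φ hφ]

/-- `v^n = v^{n mod p}` in `Multiplicative (ZMod p)`. [folklore] -/
theorem pow_mod_prime (hp : p.Prime) (v : Multiplicative (ZMod p)) (n : ℕ) : v ^ n = v ^ (n % p) := by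
  haveI : Fact p.Prime := ⟨hp⟩
  have hvp : v ^ p = 1 := by
    have h := pow_card_eq_one (x := v)
    rwa [Fintype.card_multiplicative, ZMod.card] at h
  conv_lhs => rw [← Nat.div_add_mod n p, pow_add, pow_mul, hvp, one_pow, one_mul]

/-- `t + t = 0` in `ℤ/2^{k+1}` forces `t ∈ {0, 2^k}`. [folklore] -/
theorem eq_zero_or_eq_half (t : ZMod (2 ^ (k + 1))) (ht : t + t = 0) :
    t = 0 ∨ t = ((2 ^ k : ℕ) : ZMod (2 ^ (k + 1))) := by
  haveI : NeZero (2 ^ (k + 1)) := ⟨by positivity⟩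
  have hv := ZMod.val_lt t
  have h2 : (2 : ℕ) ^ (k + 1) = 2 * 2 ^ k := by rw [pow_succ]; ring
  have hdvd : 2 ^ (k + 1) ∣ 2 * t.val := by
    rw [← ZMod.natCast_eq_zero_iff, Nat.cast_mul, ZMod.natCast_zmod_val, Nat.cast_ofNat, two_mul, ht]
  have hdvd' : 2 * 2 ^ k ∣ 2 * t.val := by rw [← h2]; exact hdvd
  obtain ⟨c, hc⟩ := Nat.dvd_of_mul_dvd_mul_left (by norm_num : 0 < 2) hdvd'
  have hc2 : c < 2 := by
    by_contra h
    have h' : 2 ^ k * 2 ≤ 2 ^ k * c := Nat.mul_le_mul_left _ (by omega)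
    omega
  interval_cases c
  · left
    rw [mul_zero] at hc
    exact (ZMod.val_eq_zero t).1 hc
  · right
    rw [← ZMod.natCast_zmod_val t, hc, mul_one]

include hφ in
/-- **`y^{2^k} = inr 2^k` is the unique involution of `C_p ⋊_r C_{2^{k+1}}`** (`p` an odd prime, `r^{2^k} ≡ 1 (mod p)`).
[cite: Dodson1984, §5.3] -/
theorem involution_eq (hp : p.Prime) (hp2 : p ≠ 2) (hr : r ^ 2 ^ k % p = 1)
    (g : Multiplicative (ZMod p) ⋊[φ] Multiplicative (ZMod (2 ^ (k + 1)))) (hg : g * g = 1) (hg1 : g ≠ 1) :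
    g = SemidirectProduct.inr (Multiplicative.ofAdd ((2 ^ k : ℕ) : ZMod (2 ^ (k + 1)))) := by
  haveI : NeZero (2 ^ (k + 1)) := ⟨by positivity⟩
  obtain ⟨v, t⟩ := g
  have ht : t * t = 1 := by have := congrArg SemidirectProduct.right hg; simpa using this
  have htt : Multiplicative.toAdd t = 0 ∨ Multiplicative.toAdd t = ((2 ^ k : ℕ) : ZMod (2 ^ (k + 1))) :=
    eq_zero_or_eq_half _ (by rw [← toAdd_mul, ht, toAdd_one])
  have hφt : ∀ w, φ t w = w := fun w => by
    rw [phi_apply r φ hφ, pow_mod_prime hp]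
    rcases htt with h | h
    · rw [h, ZMod.val_zero, pow_zero, Nat.one_mod_eq_one.2 hp.one_lt.ne', pow_one]
    · have hval : (((2 ^ k : ℕ) : ZMod (2 ^ (k + 1)))).val = 2 ^ k :=
        ZMod.val_natCast_of_lt (Nat.pow_lt_pow_right (by norm_num) (by omega))
      rw [h, hval, hr, pow_one]
  have hl : v * v = 1 := by
    have := congrArg SemidirectProduct.left hg
    simpa [hφt] using this
  have hv : v = 1 := GaloisCyclicSemidirectEight.eq_one_of_mul_self hp hp2 v hl
  subst hv
  rcases htt with h | h
  · exfalso; apply hg1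
    have : t = 1 := by rw [← ofAdd_toAdd t, h]; rfl
    subst this; rfl
  · have : t = Multiplicative.ofAdd (((2 ^ k : ℕ) : ZMod (2 ^ (k + 1)))) := by rw [← ofAdd_toAdd t, h]
    subst this; rfl

variable {K : Type} [Field K] [NumberField K] [IsCMField K]

include hφ in
/-- Complex conjugation maps to `inr 2^k` under any `e : Gal(K/ℚ) ≃* C_p ⋊_r C_{2^{k+1}}`. [folklore] -/
theorem map_complexConj_eq (hp : p.Prime) (hp2 : p ≠ 2) (hr : r ^ 2 ^ k % p = 1)
    (e : (K ≃ₐ[ℚ] K) ≃* Multiplicative (ZMod p) ⋊[φ] Multiplicative (ZMod (2 ^ (k + 1)))) :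
    e ((IsCMField.complexConj K).restrictScalars ℚ) =
      SemidirectProduct.inr (Multiplicative.ofAdd ((2 ^ k : ℕ) : ZMod (2 ^ (k + 1)))) :=
  involution_eq r φ hφ hp hp2 hr _ (model_complexConj_mul_self e rfl) (model_complexConj_ne_one e rfl)

omit [IsCMField K] in
/-- `[K:ℚ] = 2^{k+1} p`. [folklore] -/
theorem finrank_eq (hp : p.Prime) [IsGalois ℚ K]
    (e : (K ≃ₐ[ℚ] K) ≃* Multiplicative (ZMod p) ⋊[φ] Multiplicative (ZMod (2 ^ (k + 1)))) :
    Module.finrank ℚ K = 2 ^ (k + 1) * p := by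
  classical
  haveI : NeZero p := ⟨hp.ne_zero⟩
  haveI : NeZero (2 ^ (k + 1)) := ⟨by positivity⟩
  haveI : Fintype (Multiplicative (ZMod p) ⋊[φ] Multiplicative (ZMod (2 ^ (k + 1)))) :=
    Fintype.ofEquiv _ SemidirectProduct.equivProd.symm
  rw [← card_model_eq_finrank e, Fintype.card_congr SemidirectProduct.equivProd, Fintype.card_prod,
    Fintype.card_multiplicative, Fintype.card_multiplicative, ZMod.card, ZMod.card, mul_comm]

end Group

/-! ## §2 The certificate format -/

section Certificate

variable {p k : ℕ}
variable {K : Type} [Field K] [NumberField K] [IsCMField K] [IsGalois ℚ K]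

/-- **BALANCED-SET CERTIFICATE ⟹ a simple DEGENERATE CM abelian variety, for `Gal(K/ℚ) ≅ C_p ⋊_r C_{2^{k+1}}`.**
`e : Gal(K/ℚ) ≃* Multiplicative (ZMod p) ⋊[φ] Multiplicative (ZMod (2^(k+1)))`, `φ(1) = (·)^r`, `p` an odd prime,
`r^{2^k} ≡ 1 (mod p)`; in the coordinates `(v, s) ↔ u^v y^s` of `ℤ/p × ℤ/2^{k+1}` with the law
`(v₁,s₁)(v₂,s₂) = (v₁ + r^{s₁} v₂, s₁ + s₂)`: a CM set `T₀` (`x ∈ T₀ ↔ c₀ x ∉ T₀`, `c₀ = (0, 2^k)`) with trivial left stabiliser and a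
finite `D` with `2·#{x ∈ D : x g ∈ T₀} = #D` for all `g` and `c₀ D ≠ D` give a simple degenerate abelian variety of dimension `2^k p`
with CM by `K` and a rational `(q,q)` class outside the divisor ring on some power. [cite: Shimura1998, §6.2 Thm. 3 and §8.2 Prop. 26]
[cite: Gordon1999HodgeAVSurvey, Thm. 6.4 and §9.3] -/
theorem exists_simple_degenerate_of_metacyclic_balanced (hp : p.Prime) (hp2 : p ≠ 2) (r : ℕ) (hr : r ^ 2 ^ k % p = 1)
    (φ : Multiplicative (ZMod (2 ^ (k + 1))) →* MulAut (Multiplicative (ZMod p)))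
    (hφ : ∀ v : Multiplicative (ZMod p), φ (Multiplicative.ofAdd 1) v = v ^ r)
    (e : (K ≃ₐ[ℚ] K) ≃* Multiplicative (ZMod p) ⋊[φ] Multiplicative (ZMod (2 ^ (k + 1))))
    (T₀ : Finset (ZMod p × ZMod (2 ^ (k + 1))))
    (hcm : ∀ x : ZMod p × ZMod (2 ^ (k + 1)), x ∈ T₀ ↔
      (((0 : ZMod p), ((2 ^ k : ℕ) : ZMod (2 ^ (k + 1)))).1 +
          ((r : ZMod p) ^ (((0 : ZMod p), ((2 ^ k : ℕ) : ZMod (2 ^ (k + 1)))).2).val) * x.1,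
        (((0 : ZMod p), ((2 ^ k : ℕ) : ZMod (2 ^ (k + 1)))).2 + x.2)) ∉ T₀)
    (hprim : ∀ v : ZMod p × ZMod (2 ^ (k + 1)), v ≠ ((0 : ZMod p), (0 : ZMod (2 ^ (k + 1)))) →
      ∃ w : ZMod p × ZMod (2 ^ (k + 1)), ¬ (w ∈ T₀ ↔ (v.1 + (r : ZMod p) ^ v.2.val * w.1, v.2 + w.2) ∈ T₀))
    (D : Finset (ZMod p × ZMod (2 ^ (k + 1))))
    (hbal : ∀ g : ZMod p × ZMod (2 ^ (k + 1)),
      2 * (D.filter fun x => (x.1 + (r : ZMod p) ^ x.2.val * g.1, x.2 + g.2) ∈ T₀).card = D.card)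
    (hmov : ∃ x ∈ D,
      (((0 : ZMod p), ((2 ^ k : ℕ) : ZMod (2 ^ (k + 1)))).1 +
          ((r : ZMod p) ^ (((0 : ZMod p), ((2 ^ k : ℕ) : ZMod (2 ^ (k + 1)))).2).val) * x.1,
        (((0 : ZMod p), ((2 ^ k : ℕ) : ZMod (2 ^ (k + 1)))).2 + x.2)) ∉ D) :
    ∃ (Φ : CMType K) (φ₀ : K →+* ℂ) (A : AbelianVariety ℂ) (ι : 𝓞 K →+* End A)
      (θ : K →+* Module.End ℂ (complexBetti A.X 1)),
      IsPrimitive (ℂ ≃+* ℂ) Φ.1 φ₀ ∧ ¬ IsNondegenerate Φ ∧ IsCMTypeRealisation Φ A ι θ ∧ A.IsSimple ∧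
      A.dim = 2 ^ k * p ∧
      ∃ n q : ℕ, ∃ x : complexBetti (⨁ fun _ : Fin n => A).X (2 * q), IsRationalClass x ∧
        IsOfHodgeType (⨁ fun _ : Fin n => A).dim (⨁ fun _ : Fin n => A).X (2 * q) q q x ∧
        x ∉ divisorClassesSpan (⨁ fun _ : Fin n => A).X (⨁ fun _ : Fin n => A).dim q := by
  classical
  haveI : NeZero p := ⟨hp.ne_zero⟩
  haveI : NeZero (2 ^ (k + 1)) := ⟨by positivity⟩
  -- the coordinates `u^v y^s ↦ (v, s)`
  set e' : (K ≃ₐ[ℚ] K) ≃ ZMod p × ZMod (2 ^ (k + 1)) :=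
    e.toEquiv.trans (SemidirectProduct.equivProd.trans (Equiv.prodCongr Multiplicative.toAdd Multiplicative.toAdd))
    with he'_def
  have he' : ∀ σ : K ≃ₐ[ℚ] K, e' σ = (Multiplicative.toAdd (e σ).left, Multiplicative.toAdd (e σ).right) := fun σ => rfl
  have hmul : ∀ σ τ : K ≃ₐ[ℚ] K, e' (σ * τ) =
      (fun x y : ZMod p × ZMod (2 ^ (k + 1)) => (x.1 + (r : ZMod p) ^ x.2.val * y.1, x.2 + y.2)) (e' σ) (e' τ) :=
    fun σ τ => by
    simp only [he', map_mul]
    rw [toAdd_mul_left r φ hφ, SemidirectProduct.mul_right, toAdd_mul, Nat.cast_pow]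
  have hc : e' ((IsCMField.complexConj K).restrictScalars ℚ) = ((0 : ZMod p), ((2 ^ k : ℕ) : ZMod (2 ^ (k + 1)))) := by
    rw [he', map_complexConj_eq r φ hφ hp hp2 hr e, SemidirectProduct.left_inr, SemidirectProduct.right_inr, toAdd_one,
      toAdd_ofAdd]
  have ho : e' 1 = ((0 : ZMod p), (0 : ZMod (2 ^ (k + 1)))) := by
    rw [he', map_one, SemidirectProduct.one_left, SemidirectProduct.one_right, toAdd_one, toAdd_one]
  have h := exists_simple_degenerate_of_table_balanced
    (fun x y : ZMod p × ZMod (2 ^ (k + 1)) => (x.1 + (r : ZMod p) ^ x.2.val * y.1, x.2 + y.2))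
    e' hmul _ hc _ ho T₀ hcm hprim D hbal hmov
  have hcard : Fintype.card (ZMod p × ZMod (2 ^ (k + 1))) / 2 = 2 ^ k * p := by
    rw [Fintype.card_prod, ZMod.card, ZMod.card, pow_succ, show p * (2 ^ k * 2) = 2 ^ k * p * 2 by ring,
      Nat.mul_div_cancel _ (by norm_num)]
  rwa [hcard] at h

/-- **The same for the INVERSION action** (`φ(1) = (·)⁻¹`, the hypothesis of the `CorCM/GaloisCyclicSemidirectTwoPower*` files:
`k + 1 = a + 2`, `r = p − 1`, `c₀ = (0, 2^{a+1})`): law `(v₁,s₁)(v₂,s₂) = (v₁ + (p−1)^{s₁} v₂, s₁ + s₂)`, dimension `2^{a+1} p`.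
[cite: Shimura1998, §6.2 Thm. 3 and §8.2 Prop. 26] [cite: Gordon1999HodgeAVSurvey, Thm. 6.4 and §9.3] -/
theorem exists_simple_degenerate_of_inversion_balanced {a : ℕ} (hp : p.Prime) (hp2 : p ≠ 2)
    (φ : Multiplicative (ZMod (2 ^ (a + 2))) →* MulAut (Multiplicative (ZMod p)))
    (hφ : ∀ v : Multiplicative (ZMod p), φ (Multiplicative.ofAdd 1) v = v⁻¹)
    (e : (K ≃ₐ[ℚ] K) ≃* Multiplicative (ZMod p) ⋊[φ] Multiplicative (ZMod (2 ^ (a + 2))))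
    (T₀ : Finset (ZMod p × ZMod (2 ^ (a + 2))))
    (hcm : ∀ x : ZMod p × ZMod (2 ^ (a + 2)), x ∈ T₀ ↔
      (((0 : ZMod p), ((2 ^ (a + 1) : ℕ) : ZMod (2 ^ (a + 2)))).1 +
          (((p - 1 : ℕ) : ZMod p) ^ (((0 : ZMod p), ((2 ^ (a + 1) : ℕ) : ZMod (2 ^ (a + 2)))).2).val) * x.1,
        (((0 : ZMod p), ((2 ^ (a + 1) : ℕ) : ZMod (2 ^ (a + 2)))).2 + x.2)) ∉ T₀)
    (hprim : ∀ v : ZMod p × ZMod (2 ^ (a + 2)), v ≠ ((0 : ZMod p), (0 : ZMod (2 ^ (a + 2)))) →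
      ∃ w : ZMod p × ZMod (2 ^ (a + 2)), ¬ (w ∈ T₀ ↔ (v.1 + ((p - 1 : ℕ) : ZMod p) ^ v.2.val * w.1, v.2 + w.2) ∈ T₀))
    (D : Finset (ZMod p × ZMod (2 ^ (a + 2))))
    (hbal : ∀ g : ZMod p × ZMod (2 ^ (a + 2)),
      2 * (D.filter fun x => (x.1 + ((p - 1 : ℕ) : ZMod p) ^ x.2.val * g.1, x.2 + g.2) ∈ T₀).card = D.card)
    (hmov : ∃ x ∈ D,
      (((0 : ZMod p), ((2 ^ (a + 1) : ℕ) : ZMod (2 ^ (a + 2)))).1 +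
          (((p - 1 : ℕ) : ZMod p) ^ (((0 : ZMod p), ((2 ^ (a + 1) : ℕ) : ZMod (2 ^ (a + 2)))).2).val) * x.1,
        (((0 : ZMod p), ((2 ^ (a + 1) : ℕ) : ZMod (2 ^ (a + 2)))).2 + x.2)) ∉ D) :
    ∃ (Φ : CMType K) (φ₀ : K →+* ℂ) (A : AbelianVariety ℂ) (ι : 𝓞 K →+* End A)
      (θ : K →+* Module.End ℂ (complexBetti A.X 1)),
      IsPrimitive (ℂ ≃+* ℂ) Φ.1 φ₀ ∧ ¬ IsNondegenerate Φ ∧ IsCMTypeRealisation Φ A ι θ ∧ A.IsSimple ∧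
      A.dim = 2 ^ (a + 1) * p ∧
      ∃ n q : ℕ, ∃ x : complexBetti (⨁ fun _ : Fin n => A).X (2 * q), IsRationalClass x ∧
        IsOfHodgeType (⨁ fun _ : Fin n => A).dim (⨁ fun _ : Fin n => A).X (2 * q) q q x ∧
        x ∉ divisorClassesSpan (⨁ fun _ : Fin n => A).X (⨁ fun _ : Fin n => A).dim q := by
  haveI : Fact p.Prime := ⟨hp⟩
  -- `v⁻¹ = v^{p−1}` and `(p−1)^{2^{a+1}} ≡ 1 (mod p)`
  have hφ' : ∀ v : Multiplicative (ZMod p), φ (Multiplicative.ofAdd 1) v = v ^ (p - 1) := fun v => by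
    rw [hφ]
    have hvp : v ^ p = 1 := by
      have h := pow_card_eq_one (x := v)
      rwa [Fintype.card_multiplicative, ZMod.card] at h
    refine (eq_inv_of_mul_eq_one_left ?_).symm
    rw [← pow_succ, Nat.sub_add_cancel hp.one_le, hvp]
  have hr : (p - 1) ^ 2 ^ (a + 1) % p = 1 := by
    have h2 := hp.two_le
    have hsq : (p - 1) ^ 2 = p * (p - 2) + 1 := by
      zify [show 1 ≤ p by omega, show 2 ≤ p by omega]; ring
    rw [pow_succ', pow_mul, hsq, Nat.pow_mod, Nat.mul_add_mod, Nat.mod_eq_of_lt hp.one_lt, one_pow,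
      Nat.mod_eq_of_lt hp.one_lt]
  exact exists_simple_degenerate_of_metacyclic_balanced (k := a + 1) hp hp2 (p - 1) hr φ hφ' e T₀ hcm hprim D hbal hmov

end Certificate

end Summit.HodgeConjecture.CorCM.GaloisOddMetacyclic

end
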